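import Literature.AnabelianGeometry.EtaleTheta.Discharge.Sec5Def54ClausesOfUnitsEmbedding
import Literature.AnabelianGeometry.EtaleTheta.Thm56SubdagProofs

/-!
# [EtTh] Proposition 5.5 (both halves) with the theta-saturation binder `hB` REPLACED BY NAME by the constants dictionary,
# one unit of order `l·N`, and the Prop. 5.5 identification `ν` — the END-KNIT of `Sec5Def54ClausesOfUnitsEmbedding` (p498191)

Mochizuki, *The étale theta function and its Frobenioid-theoretic manifestations*, Publ. RIMS **45** (2009), Prop. 5.5 pp.327–328
(PDF pp.101–102): «the second Kummer class of Proposition 5.2, (iii), determines an isomorphism `(l·Δ_Θ)_S ⊗ ℤ/Nℤ ⥲ μ_N(S)` for all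
`(l, N)`-theta-saturated `S ∈ Ob(C)`. This isomorphism is functorial …»; Def. 5.4 p.327; Lemma 5.8 p.331 (PDF p.105) (the constants of
`B_N`).  [cite: MochizukiEtTh2009, Prop 5.5 p.327–328 (PDF pp.101–102)]

abc-iut cell, layer L2, seat abc-iut-L2-t4 (gen 9), row «PROP55-END-KNIT {hD, hζ} BY NAME» (abc-iut-L2-lead R1271 GO (a)).  PROOF-ONLY:
no definition, no new `Prop`, no instance, no notation; nothing landed is edited or restated.  Consumed BY NAME: the GENERIC Prop. 5.5
closers of the Thm. 5.6 sub-DAG `ThetaFrobenioid.Thm56Sub.rigidityFamily_exists_of` (existence half, P55-A) and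
`ThetaFrobenioid.Thm56Sub.cyclotomicRigidity_of_sub` (existence + uniqueness = abc-iut-L2-t4's `CyclotomicRigidity`) — both over an
ARBITRARY §5 datum `𝔉`, both binding `hB : IsThetaSaturated B_N` next to `ν : (l·Δ_Θ)_{B_N} ⊗ ℤ/N ≃ μ_N(B_N)` — and this seat's
`BiratAutAction.ConstantsDictionary.isThetaSaturated_BN_of_mulEquiv_muTorsion` (p498191: `hB ⟸ {hD, hζ, ν}`).

WHAT IS PROVED — for EVERY §5 datum `𝔉` carrying abc-iut-L2-t11's constants dictionary `hD` (the displayed class-J′ input shared with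
Lemma 5.8 / Thm. 5.10):
* `rigidityFamily_exists_of_constantsDictionary` — Prop. 5.5 EXISTENCE (P55-A) with `hB` replaced by
  `hD.isThetaSaturated_BN_of_mulEquiv_muTorsion hζ ν`: binders {hD, hζ : one unit of `B_N` of order `l·N`, ν, hreach, hind, hUc, hUi, hLc, hLi};
* **`cyclotomicRigidity_of_sub_of_constantsDictionary`** — the Prop. 5.5 closer `CyclotomicRigidity 𝔉 P hB` AT THE SAME `hB`-term:
  binders {hD, hζ, P, hK (Prop. 5.2 (iii) pin), hη, hcentral, hreach, hind, hUc, hUi, hLc, hLi, hcov} — i.e. the closer of record with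
  `hB ↦ {hD (by name), hζ, ν}`; everything else unchanged.
Since `hB` only ever enters the closers as a PROOF (of a `Prop`), every consumer of `CyclotomicRigidity 𝔉 P hB` / `IsKummerDetermined … hB`
accepts this `hB`-term definitionally (proof irrelevance): the knit is by-name bookkeeping for the cell's binder lists, not new mathematics.
HONEST FRAMING: no carrier of record is claimed; `hD` is displayed, never discharged here; [EtTh] is a refereed paper and nothing here bears
on [IUTchIII] Cor. 3.12 — no side taken; typed ≠ proved except the theorems below; nothing asserts abc proved or refuted.
-/

namespace Literature.AnabelianGeometry.EtaleTheta

open CategoryTheory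
open FrobenioidCyclotomicRigidity
open Literature.AlgebraicGeometry.Frobenioids

universe w u u' v'

namespace ThetaFrobenioid

namespace Thm56Sub

variable {C₀ : Type u} [Category.{0} C₀] {D₀ : Type u'} [Category.{v'} D₀] {𝔉 : ThetaFrobenioid.{w} C₀ D₀}
  {α : 𝔉.BiratAutAction} {p : ℕ} [Fact p.Prime] {Dθ : ThetaSetting p} {E : Dθ.EtaleThetaData} {l : ℕ}
  {Cu : E.DoubleUnderline l} {μ : Dθ.CyclotomeMod l 𝔉.N} {hC : Dθ.Compat} {hS : Dθ.Sec2Hyps}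
  {ιT : 𝔉.PiX ≃ₜ* (Cu.thetaEnvData μ hC hS).PiX} {m : 𝔉.muTorsion 𝔉.BN 𝔉.N ≃* (Cu.thetaEnvData μ hC hS).mu}
  {Cst : Subgroup (𝔉.biratUnits 𝔉.BN)} {νK : Cst →* (PadicAlgCl p)ˣ}
  (hD : BiratAutAction.ConstantsDictionary α Cu μ hC hS ιT m Cst νK)

include hD

/-- **Prop. 5.5, EXISTENCE half (P55-A), with `hB ↦ {hD, hζ, ν}`**: a candidate rigidity family extending `ν` and functorial for the
linear morphisms of theta-saturated objects exists — abc-iut-w5-d020's generic `rigidityFamily_exists_of` at the theta-saturation proof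
`hD.isThetaSaturated_BN_of_mulEquiv_muTorsion hζ ν` (p498191).  [cite: MochizukiEtTh2009, Prop 5.5 p.327–328 (PDF pp.101–102)] -/
theorem rigidityFamily_exists_of_constantsDictionary (hζ : ∃ u ∈ 𝔉.units 𝔉.BN, orderOf u = 𝔉.l * (𝔉.N : ℕ))
    (ν : 𝔉.lDeltaModN 𝔉.BN ≃* 𝔉.muTorsion 𝔉.BN 𝔉.N)
    (hreach : BijectivelyReachableFromBN 𝔉) (hind : TransportIndependent 𝔉 ν)
    (hUc : UnitsPullComp 𝔉) (hUi : UnitsPullId 𝔉) (hLc : LDeltaMapComp 𝔉) (hLi : LDeltaMapId 𝔉) :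
    ∃ ρ : RigidityFamily 𝔉,
      (∀ x, ρ 𝔉.BN (hD.isThetaSaturated_BN_of_mulEquiv_muTorsion hζ ν) x = ν x) ∧ IsFunctorialLinear 𝔉 ρ :=
  rigidityFamily_exists_of (hD.isThetaSaturated_BN_of_mulEquiv_muTorsion hζ ν) ν hreach hind hUc hUi hLc hLi

/-- **[EtTh] Proposition 5.5 — the closer of record `CyclotomicRigidity 𝔉 P hB` with `hB` REPLACED BY NAME by
`{hD (constants dictionary), hζ (one unit of B_N of order l·N), ν}`** (`hB := hD.isThetaSaturated_BN_of_mulEquiv_muTorsion hζ ν`,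
p498191); all other binders are those of abc-iut-w5-d020's generic `cyclotomicRigidity_of_sub` verbatim: the Prop. 5.2 (iii) pin `hK`
(`ThetaPairKummerClass η ν`), `hη`, `hcentral`, bijective reachability `hreach`, transport independence `hind`, the transport laws
`hUc hUi hLc hLi`, and abc-iut-L2-t11's coverage `hcov`.  Net binder change vs the closer of record: `−hB +hζ` (+ `hD`, the class-J′ input
already displayed for Lemma 5.8 / Thm. 5.10).  [cite: MochizukiEtTh2009, Prop 5.5 p.327–328 (PDF pp.101–102)] -/
theorem cyclotomicRigidity_of_sub_of_constantsDictionary (hζ : ∃ u ∈ 𝔉.units 𝔉.BN, orderOf u = 𝔉.l * (𝔉.N : ℕ))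
    (P : ThetaSubquotientProj 𝔉) {η : 𝔉.HB → 𝔉.lDeltaModN 𝔉.BN} {ν : 𝔉.lDeltaModN 𝔉.BN ≃* 𝔉.muTorsion 𝔉.BN 𝔉.N}
    (hK : FrobenioidThetaBiKummer.ThetaPairKummerClass 𝔉 η ν) (hη : EtaTautological 𝔉 P η)
    (hcentral : UnitsCentralUnderLDelta 𝔉 P) (hreach : BijectivelyReachableFromBN 𝔉)
    (hind : TransportIndependent 𝔉 ν) (hUc : UnitsPullComp 𝔉) (hUi : UnitsPullId 𝔉) (hLc : LDeltaMapComp 𝔉)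
    (hLi : LDeltaMapId 𝔉) (hcov : LDeltaCovered 𝔉 P) :
    CyclotomicRigidity 𝔉 P (hD.isThetaSaturated_BN_of_mulEquiv_muTorsion hζ ν) :=
  cyclotomicRigidity_of_sub P _ hK hη hcentral hreach hind hUc hUi hLc hLi hcov

/-- The same closer READ AT ANY OTHER theta-saturation proof `hB` (proof irrelevance): once `{hD, hζ, ν}` are available, Prop. 5.5 holds
for every `hB` the consumers may carry.  [cite: MochizukiEtTh2009, Prop 5.5 p.327–328 (PDF pp.101–102)] -/
theorem cyclotomicRigidity_of_sub_of_constantsDictionary' (hζ : ∃ u ∈ 𝔉.units 𝔉.BN, orderOf u = 𝔉.l * (𝔉.N : ℕ))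
    (P : ThetaSubquotientProj 𝔉) {η : 𝔉.HB → 𝔉.lDeltaModN 𝔉.BN} {ν : 𝔉.lDeltaModN 𝔉.BN ≃* 𝔉.muTorsion 𝔉.BN 𝔉.N}
    (hK : FrobenioidThetaBiKummer.ThetaPairKummerClass 𝔉 η ν) (hη : EtaTautological 𝔉 P η)
    (hcentral : UnitsCentralUnderLDelta 𝔉 P) (hreach : BijectivelyReachableFromBN 𝔉)
    (hind : TransportIndependent 𝔉 ν) (hUc : UnitsPullComp 𝔉) (hUi : UnitsPullId 𝔉) (hLc : LDeltaMapComp 𝔉)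
    (hLi : LDeltaMapId 𝔉) (hcov : LDeltaCovered 𝔉 P) (hB : 𝔉.IsThetaSaturated 𝔉.BN) :
    CyclotomicRigidity 𝔉 P hB :=
  cyclotomicRigidity_of_sub_of_constantsDictionary hD hζ P hK hη hcentral hreach hind hUc hUi hLc hLi hcov

end Thm56Sub

end ThetaFrobenioid

end Literature.AnabelianGeometry.EtaleTheta
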